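import Literature.Analysis.FluidPDE.DeRosaGluingPotential
import Literature.Analysis.FluidPDE.OnsagerBDSVCommutatorHolds
import Literature.Analysis.FluidPDE.DeRosaPerturbationHolds
import Literature.Analysis.FluidPDE.DeRosaStagesProofs
import Literature.Analysis.FluidPDE.DeRosaTimeRegularityProofs
import HarnessLib

/-!
# De Rosa 2019, Thm. 2.1 from short-time existence for the fractional Navier–Stokes equations
# alone (the current frontier of `DeRosa2019_thm21`)

Analysis/FluidPDE proof file (theorems only; no definitions, no named facts), support for the
discharge of `Literature.Analysis.FluidPDE.DeRosa2019_thm21` (L. De Rosa, *Infinitely many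
Leray–Hopf solutions for the fractional Navier–Stokes equations*, Comm. PDE 44 (2019) =
arXiv:1801.10235, §2 Thm. 2.1).

With the discharges now in the tree —
* the commutator estimate `BDSV.commutatorCZBound_holds` (`OnsagerBDSVCommutatorHolds`, from
  `OnsagerBDSVCommutatorZero` / `OnsagerBDSVCommutatorReduction`),
* the perturbation stage `DeRosa.perturbationStage_holds` (`DeRosaPerturbationHolds`, §§5.3–5.5),
* the mollification stage and the assembly of Prop. 4.1 from the three stages
  (`DeRosa.iterativeSchemeLT_of_gluing_of_perturbation`, `DeRosaStagesProofs`),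
* the time-regularity step of §4.2 (`DeRosa.timeRegularity_holds`, `DeRosaTimeRegularityProofs`),
* the gluing stage §5.2 from local existence and the commutator estimate
  (`DeRosa.gluingStage_of_localExistence₀_of_commutatorCZBound`, `DeRosaGluingPotential`) —
the ONLY outstanding published input under Thm. 2.1 is the short-time existence of smooth
solutions of the fractional Navier–Stokes equations with life span `c/‖u₀‖_{1+α}`
(De Rosa §3.2, Thm. 3.4 with Prop. 3.5: "Given any initial data `u₀ ∈ C^∞`, and
`T ≤ c‖u₀‖_{1+α}⁻¹`, there exists a unique solution `v` of (3.8) on `[0,T]`"; Majda–Bertozzi 2002,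
Ch. 3 Thm. 3.4 by the energy method). This file records the three one-hypothesis reductions

* `DeRosa.gluingStage_of_localExistence₀` — local existence at time `0` ⟹ `DeRosa.gluingStage`;
* `DeRosa.iterativeSchemeLT_of_localExistence₀` — ⟹ Prop. 4.1 run from zero;
* `DeRosa2019_thm21_of_localExistence₀` — ⟹ `DeRosa2019_thm21`,

so that `DeRosa2019_thm21_holds` is `DeRosa2019_thm21_of_localExistence₀ h` for any proof `h` of
the local existence statement (stated inline, exactly as the hypothesis `hloc₀` of
`DeRosa.gluingStage_of_localExistence₀_of_commutatorCZBound`; it is being assembled in the tree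
from `GalerkinSmoothHm` … `GalerkinSmoothSolution`, `FracNSContinuation`, `DeRosa.fracNSApriori`).

## References

* L. De Rosa, *Infinitely many Leray–Hopf solutions for the fractional Navier–Stokes equations*,
  Comm. PDE 44 (2019), arXiv:1801.10235: §2 Thm. 2.1, §3.2 Thm. 3.4 / Prop. 3.5, §4 Prop. 4.1,
  §4.2 (proof of Thm. 2.1), §5 (proof of Prop. 4.1). [`Derosa2018`]
* T. Buckmaster, C. De Lellis, L. Székelyhidi Jr., V. Vicol, *Onsager's conjecture for admissible
  weak solutions*, CPAM 72 (2019), arXiv:1701.08678, App. D Prop. D.1. [`BuckmasterEtAl2018`]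
* A. J. Majda, A. L. Bertozzi, *Vorticity and Incompressible Flow*, CUP 2002, §3.2 Thm. 3.4.
-/

open MeasureTheory Set Filter Topology Function
open scoped NNReal ENNReal ContDiff

namespace Literature.Analysis.FluidPDE

open FunctionSpaces FunctionSpaces.Torus

namespace DeRosa

/-- **De Rosa's gluing stage from local existence at time `0` alone** (§5.2: Cor. 5.2,
Props. 5.3–5.5 and the glued triple), the commutator estimate of BDSV App. D being discharged
(`BDSV.commutatorCZBound_holds`). The hypothesis is De Rosa's Thm. 3.4 / Prop. 3.5 existence
clause in the CFL form used by the scheme: for `0 < α < 1`, `0 < γ < 1` there is `c > 0` such that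
for every viscosity `ν > 0`, every smooth divergence-free datum `u₀` with `‖u₀‖_{1,α} ≤ K` and
every `T' > 0` with `T'K ≤ c` there is a smooth exact solution (`Torus.IsFracNSReynoldsOn` with
zero stress) on `[0, T']` starting from `u₀`.
[cite: Derosa2018, §3.2 Thm. 3.4, Prop. 3.5; §5.2] -/
theorem gluingStage_of_localExistence₀
    (hloc₀ : ∀ α : ℝ, 0 < α → α < 1 → ∀ γ : ℝ, 0 < γ → γ < 1 → ∃ c : ℝ, 0 < c ∧
      ∀ ν : ℝ, 0 < ν → ∀ (u₀ : UnitAddTorus (Fin 3) → EuclideanSpace ℝ (Fin 3)),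
        IsSmooth u₀ → IsDivFree u₀ → ∀ K : ℝ, 0 ≤ K →
          Torus.eContDiffHolderNorm 1 (Real.toNNReal α) u₀ ≤ ENNReal.ofReal K →
          ∀ T' : ℝ, 0 < T' → T' * K ≤ c →
            ∃ (v : ℝ → UnitAddTorus (Fin 3) → EuclideanSpace ℝ (Fin 3)) (p : ℝ → UnitAddTorus (Fin 3) → ℝ),
              Torus.IsFracNSReynoldsOn (Icc 0 T') γ ν v p (fun _ _ _ => 0) ∧ v 0 = u₀) :
    gluingStage :=
  gluingStage_of_localExistence₀_of_commutatorCZBound hloc₀ BDSV.commutatorCZBound_holds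

/-- **De Rosa's Prop. 4.1 run from zero (`DeRosa.iterativeSchemeLT`, regime `γ < β`) from local
existence at time `0` alone**: the three stages of §5 with the mollification stage
(`DeRosa.mollificationStage_holds`, inside `iterativeSchemeLT_of_gluing_of_perturbation`), the
perturbation stage (`DeRosa.perturbationStage_holds`) and the commutator estimate discharged.
[cite: Derosa2018, §4 Prop. 4.1, §5; §3.2 Thm. 3.4] -/
theorem iterativeSchemeLT_of_localExistence₀
    (hloc₀ : ∀ α : ℝ, 0 < α → α < 1 → ∀ γ : ℝ, 0 < γ → γ < 1 → ∃ c : ℝ, 0 < c ∧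
      ∀ ν : ℝ, 0 < ν → ∀ (u₀ : UnitAddTorus (Fin 3) → EuclideanSpace ℝ (Fin 3)),
        IsSmooth u₀ → IsDivFree u₀ → ∀ K : ℝ, 0 ≤ K →
          Torus.eContDiffHolderNorm 1 (Real.toNNReal α) u₀ ≤ ENNReal.ofReal K →
          ∀ T' : ℝ, 0 < T' → T' * K ≤ c →
            ∃ (v : ℝ → UnitAddTorus (Fin 3) → EuclideanSpace ℝ (Fin 3)) (p : ℝ → UnitAddTorus (Fin 3) → ℝ),
              Torus.IsFracNSReynoldsOn (Icc 0 T') γ ν v p (fun _ _ _ => 0) ∧ v 0 = u₀) :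
    iterativeSchemeLT :=
  iterativeSchemeLT_of_gluing_of_perturbation (gluingStage_of_localExistence₀ hloc₀)
    perturbationStage_holds

end DeRosa

/-- **De Rosa 2019, Thm. 2.1 from short-time existence for the fractional Navier–Stokes
equations alone** — the current frontier of `DeRosa2019_thm21`: every other input of De Rosa's
proof (Prop. 4.1 = mollification + gluing + perturbation stages of §5, the commutator estimate of
BDSV App. D used in §5.2, the time-regularity step and the assembly of §4.2) is proved in the
tree, so Thm. 2.1 follows from the existence clause of Thm. 3.4 / Prop. 3.5 (smooth solutions of
(3.8) on `[0, T]` for `T‖u₀‖_{1+α} ≤ c`) and nothing else; `DeRosa2019_thm21_holds` is this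
theorem applied to a proof of that clause.
[cite: Derosa2018, §2 Thm. 2.1, §4.2 (proof of Thm. 2.1), §3.2 Thm. 3.4 / Prop. 3.5] -/
theorem DeRosa2019_thm21_of_localExistence₀
    (hloc₀ : ∀ α : ℝ, 0 < α → α < 1 → ∀ γ : ℝ, 0 < γ → γ < 1 → ∃ c : ℝ, 0 < c ∧
      ∀ ν : ℝ, 0 < ν → ∀ (u₀ : UnitAddTorus (Fin 3) → EuclideanSpace ℝ (Fin 3)),
        IsSmooth u₀ → IsDivFree u₀ → ∀ K : ℝ, 0 ≤ K →
          FunctionSpaces.Torus.eContDiffHolderNorm 1 (Real.toNNReal α) u₀ ≤ ENNReal.ofReal K →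
          ∀ T' : ℝ, 0 < T' → T' * K ≤ c →
            ∃ (v : ℝ → UnitAddTorus (Fin 3) → EuclideanSpace ℝ (Fin 3)) (p : ℝ → UnitAddTorus (Fin 3) → ℝ),
              Torus.IsFracNSReynoldsOn (Icc 0 T') γ ν v p (fun _ _ _ => 0) ∧ v 0 = u₀) :
    DeRosa2019_thm21 :=
  DeRosa2019_thm21_of_iterativeSchemeLT_of_timeRegularity
    (DeRosa.iterativeSchemeLT_of_localExistence₀ hloc₀) DeRosa.timeRegularity_holds

end Literature.Analysis.FluidPDE
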